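import Summits.Langlands.Langlands.Theorems.QuadraticWindowHostInducedRepTotallyRealInduction
import Literature.NumberTheory.Automorphic.ReciprocityGLnRankOneProofs
import Summits.Langlands.Langlands.Theorems.QuadraticWindowHostInducedRepSlicesDefs
import HarnessLib

/-!
# The rank `≤ 1` strata of the crux `QuadraticWindow.HostInducedRep` are theorems

Crux `Summit.Langlands.Langlands.Theses.QuadraticWindow.HostInducedRep` (item stmt-Langlands-10902, line
`one-transparent-pane`), sliced by the rank as `HostInducedRepAt n`
(`QuadraticWindowHostInducedRepSlicesDefs.lean`).  This file proves, with NO named fact: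

* `hostInducedRepAt_zero` — the stratum `n = 0` holds vacuously: a Satake parameter has `card = n`, so the
  twist-nontriviality hypothesis of the crux is unsatisfiable in rank `0` (`pos_of_twistNontrivial`);
* `hostInducedRepAt_one` — the stratum `n = 1` holds outright: the algebraic Hecke character `χ_π` of a
  regular algebraic `π` on `GL₁/F` (`exists_heckeCharacter_glOne`,
  `isAlgebraic_heckeCharacter_glOne_of_isCAlgebraic`) has Weil's `ℓ`-adic character with place-by-place
  control (`HeckeCharacter.IsAlgebraic.exists_lAdic`) — `rankOne_reciprocity`; twisting by the `ℓ`-adic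
  avatar of the Artin character `eψ` (`exists_twist_package`, landed) and inducing along the quadratic
  `F/F₀` (`hasQuadraticInduction`, landed, every rank) gives the crux's `R` with the induced Frobenius
  polynomial at EVERY good place;
* `hostInducedRep_iff_forall_two_le` — hence the crux is exactly its `n ≥ 2` part.

This is the Theorems-side landing of `Cruxes/HostInducedRep/Disproof.lean` §§1, 9, 11, 12 (disprover
gen-4, which cannot write under `Theorems/`), re-assembled from landed material of the line.  What is NOT
here: anything about ranks `≥ 2` (that is the conditional closure `QuadraticWindowHostInducedRep.lean`).

References: Weil 1956 (`ℓ`-adic characters of type-`A₀` Hecke characters); Harris–Lan–Taylor–Thorne 2016,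
proof of Thm. 7.13, case `n = 1`; Serre, *Abelian ℓ-adic representations*, Ch. III.
-/

set_option linter.dupNamespace false -- the summit-side namespace `Summit.Langlands.Langlands.…` repeats `Langlands` by design (D-0017 single-conjunct summit)

noncomputable section

open Polynomial
open scoped NumberField
open IsDedekindDomain Field NumberField Filter
open Literature.NumberTheory.GaloisRepresentations Literature.NumberTheory.Automorphic
open Summit.Langlands.Langlands.Theses.QuadraticWindow
open Summit.Langlands.Langlands.Theorems.HostInducedRep.OneTransparentPane

namespace Summit.Langlands.Langlands.Theorems.HostInducedRep.Slices


/-! ## The stratum `n = 0` -/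

/-- **The twist-nontriviality hypothesis forces `0 < n`.**  A Satake parameter has `card = n`
(`HasSatakeParamAt.card_eq`), so for `n = 0` all Satake parameters are `0` and the hypothesis
`∃ᶠ w, … β.map (· * c') ≠ α.map (· * c)` is unsatisfiable.  (Any filter; only one witness is used.)
Source: `Cruxes/HostInducedRep/Disproof.lean` §1. -/
theorem pos_of_twistNontrivial {n : ℕ} {F : Type} [Field F] [NumberField F]
    {hcpt : isCompact_glFiniteIntegralLevel n F} (π : CuspidalAutomorphicRepData n F hcpt)
    {l : Filter (HeightOneSpectrum (𝓞 F))} (g : HeightOneSpectrum (𝓞 F) → HeightOneSpectrum (𝓞 F))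
    (P Q : HeightOneSpectrum (𝓞 F) → ℂ → Prop)
    (h : ∃ᶠ w in l, ∃ (α β : Multiset ℂ) (c c' : ℂ), π.1.HasSatakeParamAt w α ∧
      π.1.HasSatakeParamAt (g w) β ∧ P w c ∧ Q w c' ∧ β.map (fun b ↦ b * c') ≠ α.map (fun a ↦ a * c)) :
    0 < n := by
  obtain ⟨w, α, β, c, c', hα, hβ, -, -, hne⟩ := h.exists
  by_contra hn
  obtain rfl : n = 0 := Nat.eq_zero_of_not_pos hn
  have hα0 : α = 0 := Multiset.card_eq_zero.mp hα.card_eq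
  have hβ0 : β = 0 := Multiset.card_eq_zero.mp hβ.card_eq
  exact hne (by rw [hα0, hβ0, Multiset.map_zero, Multiset.map_zero])

/-- **The `n = 0` stratum of the crux holds** (vacuously: its twist-nontriviality hypothesis fails by
`pos_of_twistNontrivial`).  The summit carries `0 < n`; the crux does not need to. -/
theorem hostInducedRepAt_zero : HostInducedRepAt 0 := by
  intro F₀ F _ _ _ _ _ τ _ _ _ hcpt π _ _ _ _ _ _ ℓ _ ι _ _ eψ _ _ hnti
  exact absurd (pos_of_twistNontrivial π (fun w ↦ τ • w)
    (fun w c ↦ eψ.HasFrobCharpolyAt w (X - C c)) (fun w c' ↦ eψ.HasFrobCharpolyAt (τ • w) (X - C c'))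
    hnti) (lt_irrefl 0)

/-! ## The stratum `n = 1` -/

/-- **Place-by-place reciprocity in rank one** (Weil): for a cuspidal regular algebraic `π` on
`GL₁(𝔸_F)` over ANY number field `F`, a prime `ℓ` and `ι : ℚ̄_ℓ ≃ ℂ`, there is `ρ : Γ_F → GL₁(ℚ̄_ℓ)`
which at every `w ∤ ℓ` carrying a Satake parameter `α` of `π` is unramified with arithmetic-Frobenius
characteristic polynomial `arithFrobPolyOfSatake ι q_w 1 α`.  Proof: the algebraic Hecke character
`χ_π` of `π` and its `ℓ`-adic character (`HeckeCharacter.IsAlgebraic.exists_lAdic`), exactly as in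
`HarrisLanTaylorThorne2016.theoremA_existence_rank_one` but keeping the control place by place.
Ref: Weil 1956 §1–§2; HLTT 2016, proof of Thm. 7.13 (case `n = 1`). -/
theorem rankOne_reciprocity {F : Type} [Field F] [NumberField F] {ℓ : ℕ} [Fact ℓ.Prime]
    (ι : PadicAlgCl ℓ ≃+* ℂ) {hcpt : isCompact_glFiniteIntegralLevel 1 F}
    (π : CuspidalAutomorphicRepData 1 F hcpt) (hπ : π.1.IsRegularAlgebraic) :
    ∃ ρ : FramedGaloisRep F (PadicAlgCl ℓ) 1,
      ∀ (w : HeightOneSpectrum (𝓞 F)) (α : Multiset ℂ), π.1.HasSatakeParamAt w α →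
        ((ℓ : ℕ) : 𝓞 F) ∉ w.asIdeal →
          ρ.IsUnramifiedAt w ∧ ρ.HasFrobCharpolyAt w (arithFrobPolyOfSatake ι w.residueCard 1 α) := by
  classical
  obtain ⟨χ, hχ⟩ := π.1.exists_heckeCharacter_glOne
  have halg : χ.IsAlgebraic :=
    π.1.isAlgebraic_heckeCharacter_glOne_of_isCAlgebraic hχ hπ.isCAlgebraic
  obtain ⟨r, hr⟩ := halg.exists_lAdic ι
  refine ⟨r, fun w α hα hwℓ ↦ ?_⟩
  have hur : χ.IsUnramifiedAt w := π.1.isUnramifiedAt_heckeCharacter_glOne hχ hα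
  obtain ⟨hunr, hfrob⟩ := hr w hwℓ hur
  refine ⟨hunr, ?_⟩
  obtain ⟨ϖ, hϖ, rfl⟩ := π.1.exists_eq_singleton_of_hasSatakeParamAt_glOne hχ hα
  have hc : ((χ (localUnits w ϖ) : ℂˣ) : ℂ) = χ.valueAtUniformizer w := by
    rw [← HeckeCharacter.localComponent_eq_valueAtUniformizer hur hϖ,
      HeckeCharacter.localComponent_apply]
  rw [arithFrobPolyOfSatake_one, Multiset.map_singleton, Multiset.prod_singleton, hc]
  exact hfrob

/-- **The rank-one stratum of the crux, PROVED** (`HostInducedRepAt 1`, standard axioms, no named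
fact): `ρ` from `rankOne_reciprocity`; `ρ' := ρ ⊗ ẽψ` by the landed `exists_twist_package` (the `ℓ`-adic
avatar of the Artin character `eψ` scales the Frobenius roots by `ι⁻¹(c_w⁻¹)`); `R :=` the semisimplified
`Ind_{Γ_F}^{Γ_{F₀}} ρ'` by the landed every-rank `hasQuadraticInduction` (`ρ'` is semisimple, being of
rank one), fed on the fibre of a good `v` with `P_w = arithFrobPolyOfSatake ι q_w 1 (α_w · c_w)` (`ℓ ∉ w`
because `ℓ ∉ v = w ∩ 𝓞 F₀`).  Every hypothesis of the crux other than `hdeg`, `hreg` and the guard family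
is unused in rank one (registered stub `hostInducedRepAt_one`).
Ref: `Cruxes/HostInducedRep/Disproof.lean` §12 (disprover gen-4). -/
theorem hostInducedRepAt_one : HostInducedRepAt 1 := by
  intro F₀ F _ _ _ _ _ τ _ hdeg _ hcpt π _ _ hreg _ _ _ ℓ _ ι _ _ eψ _ _ _
  obtain ⟨ρ, hρ⟩ := rankOne_reciprocity ι π hreg
  obtain ⟨ρ', hρ'⟩ := exists_twist_package ι π eψ ρ hρ
  obtain ⟨R, hRss, hR⟩ :=
    hasQuadraticInduction F₀ F ℓ 1 hdeg ρ' (FramedRep.isSemisimple_of_rank_one _)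
  refine ⟨R, hRss, fun v α c hv hguard ↦
    hR v (fun w ↦ arithFrobPolyOfSatake ι w.residueCard 1 ((α w).map (fun a ↦ a * c w)))
      fun w hw ↦ ?_⟩
  obtain ⟨he, hsat, hψu, hψc⟩ := hguard w hw
  refine ⟨he, hρ' w (α w) (c w) ?_ hsat hψu hψc⟩
  -- `ℓ ∉ w` because `ℓ ∉ v = w ∩ 𝓞 F₀`
  have hmem : ((ℓ : ℕ) : 𝓞 F) ∈ w.asIdeal ↔ ((ℓ : ℕ) : 𝓞 F₀) ∈ (w.under (𝓞 F₀)).asIdeal := by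
    rw [HeightOneSpectrum.under_asIdeal, Ideal.under_def, Ideal.mem_comap, map_natCast]
  rw [hmem, hw]
  exact hv

/-! ## The crux is its `n ≥ 2` part -/

/-- **Ranks `≥ 2` suffice**: with the strata `n = 0` and `n = 1` proved, the crux follows from its
strata of rank at least two. -/
theorem hostInducedRep_of_forall_two_le (h : ∀ n, 2 ≤ n → HostInducedRepAt n) : HostInducedRep := by
  refine slices_anchor.mpr fun n ↦ ?_
  rcases Nat.lt_or_ge n 2 with hn | hn
  · interval_cases n
    · exact hostInducedRepAt_zero
    · exact hostInducedRepAt_one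
  · exact h n hn

/-- **The crux is exactly its `n ≥ 2` part** (`HostInducedRep ↔ ∀ n ≥ 2, HostInducedRepAt n`). -/
theorem hostInducedRep_iff_forall_two_le : HostInducedRep ↔ ∀ n, 2 ≤ n → HostInducedRepAt n :=
  ⟨fun h n _ ↦ slices_anchor.mp h n, hostInducedRep_of_forall_two_le⟩

end Summit.Langlands.Langlands.Theorems.HostInducedRep.Slices

end
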